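import Mathlib.MeasureTheory.Measure.Lebesgue.Basic
import Mathlib.MeasureTheory.OuterMeasure.BorelCantelli
import Summits.HubbardSuperconductivity.HubbardSuperconductivity.Theorems.JosephsonMirrorJmCuspConditionalAssembly
import HarnessLib

/-!
# Route `JosephsonMirror` — crux `JmCusp` (stmt-HubbardSuperconductivity-2228): the Borel–Cantelli form of the
# (ii)-residue of line `cocountable-coupling-selection`

Helper file (`--supports` stmt-HubbardSuperconductivity-2228) of the lead seat c11 (cycle 3).  By the conditional
assembly (`JosephsonMirrorJmCuspConditionalAssembly`, p153748) the crux `JmCusp` is, by theorems,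
`[ordered window of zero-excess d-wave pair order — the summit's open core, ⇐ stmt-8807 | 2079 | 1634] ∧ [residue]`,
where the residue was registered in its GENERIC form R2: on some sub-window of every ordered window, eventually in even
`L`, the simple-floor couplings are dense — equivalently (pencil finiteness, p152004) the degenerate-floor couplings
`B_L` of the sub-window are FINITELY many, i.e. `volume B_L = 0`, for every large even `L`
(`degenerateCouplings_finite_iff_null` below: for the affine Hermitian pencil `U ↦ hubbardTorus 2 L 1 U` the set of
degenerate couplings of a window is either finite or of positive Lebesgue measure — nothing in between).

This file weakens the residue once more, to its Borel–Cantelli form R3 — *the coupling-measure of floor degeneracy is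
SUMMABLE along `L`*: `∑_L volume (B_L ∩ (a', b')) < ∞` on some sub-window `(a', b')`.  R3 allows a symmetry multiplet
(a momentum star, an `E` doublet of `C₄ᵥ`) to be the `(N_L, S^z = 0)` floor on whole coupling INTERVALS for
infinitely many `L`, provided their total length is summable (lengths `O(L^(-1-η))` suffice), where R2 forbids any
such interval beyond some `L₁`.  The first Borel–Cantelli lemma (`MeasureTheory.measure_setOf_frequently_eq_zero`,
valid for outer measures, so no measurability of `B_L` is needed) then says that Lebesgue-almost every coupling of the
sub-window lies in only finitely many `B_L`, i.e. has an EVENTUALLY SIMPLE floor; the sub-window has positive measure,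
so such a coupling exists, and window order at it closes the crux (`jmCusp_of_windowOrder_of_eventuallySimple`).

* `exists_mem_Ioo_eventually_not_of_tsum_ne_top` — Borel–Cantelli selection of a good point of an interval;
* `tsum_volume_ne_top_of_eventually_finite` — eventually finite exceptional sets have summable measure;
* `degenerateCouplings_finite_iff_null` — at fixed `L`, the degenerate couplings of a window are finitely many iff
  they are Lebesgue-null (real-algebraic structure of the pencil floor, `pencilFiniteness_exists_finset_finrank_const`);
* `jmCusp_of_windowOrder_of_summableDegeneracy` — window order + R3 on that window ⇒ `JmCusp`;
* `summableDegeneracy_of_finiteDegenerate`, `summableDegeneracy_of_denseSimple` — the earlier residue forms imply R3;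
* `jmCusp_of_orderedWindow_of_summableDegeneracy` — the line's composition with the two registered stubs
  (`stub_orderedWindow`, `stub_summableDegeneracy`) as hypotheses; `summableDegeneracy_of_genericSimplicity` — the
  registered R2 implies the registered R3 (certifies the reshape of the skeleton, rev c11-3);
* `jmCusp_of_logColdDWaveOrder_of_summableDegeneracy`, `jmCusp_of_bir2079_of_summableDegeneracy`,
  `jmCusp_of_thesis1634_of_summableDegeneracy` — the window supplied verbatim by the statements of the open items
  stmt-8807, stmt-2079, stmt-1634.

Pure composition plus Mathlib's first Borel–Cantelli lemma; no definition, no named fact, no physics input.  Sources: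
first Borel–Cantelli lemma (É. Borel, Rend. Circ. Mat. Palermo 27 (1909) 247; F. P. Cantelli, Atti Accad. Naz. Lincei 26
(1917) 39), Mathlib `MeasureTheory.OuterMeasure.BorelCantelli`; T. Kato, *Perturbation Theory for Linear Operators*
(1966) Ch. II §§1.1, 5.1, 6 (analytic Hermitian pencils); T. Koma, H. Tasaki, J. Stat. Phys. 76 (1994) 745, §2.
-/

noncomputable section

-- the mandated namespace `Summit.<Summit>.<Problem>.Theorems` repeats `HubbardSuperconductivity`
-- (single-problem summit, D-0017), which the `dupNamespace` linter flags on every declaration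
set_option linter.dupNamespace false

namespace Summit.HubbardSuperconductivity.HubbardSuperconductivity.Theorems.JosephsonMirror

open scoped Classical
open Matrix MeasureTheory Literature.MathematicalPhysics.QuantumLattice
open Summit.HubbardSuperconductivity.HubbardSuperconductivity.Theses.JosephsonMirror (JmCusp)

/-! ### Two measure-theoretic selection lemmas on an interval -/

/-- **Borel–Cantelli selection on an interval.**  If the Lebesgue measures of the exceptional sets
`{U ∈ (a, b) | p L U}` are summable in `L`, then some point of the (positive-measure) interval `(a, b)`, `a < b`,
is exceptional for only finitely many `L`: the set of points that are exceptional infinitely often is null by the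
first Borel–Cantelli lemma (`MeasureTheory.measure_setOf_frequently_eq_zero`, an outer-measure statement — no
measurability is required), while `volume (a, b) = b - a > 0` (`Real.volume_Ioo`). [folklore] -/
theorem exists_mem_Ioo_eventually_not_of_tsum_ne_top {p : ℕ → ℝ → Prop} {a b : ℝ} (hab : a < b)
    (hs : ∑' L : ℕ, volume {U : ℝ | U ∈ Set.Ioo a b ∧ p L U} ≠ ⊤) :
    ∃ U ∈ Set.Ioo a b, ∃ L₀ : ℕ, ∀ L : ℕ, L₀ ≤ L → ¬ p L U := by
  have h0 : volume {U : ℝ | ∃ᶠ L in Filter.atTop, U ∈ Set.Ioo a b ∧ p L U} = 0 :=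
    measure_setOf_frequently_eq_zero hs
  by_contra hcon
  push Not at hcon
  have hsub : Set.Ioo a b ⊆ {U : ℝ | ∃ᶠ L in Filter.atTop, U ∈ Set.Ioo a b ∧ p L U} := by
    intro U hU
    simp only [Set.mem_setOf_eq, Filter.frequently_atTop]
    intro L₀
    obtain ⟨L, hL, hp⟩ := hcon U hU L₀
    exact ⟨L, hL, hU, hp⟩
  have hI : volume (Set.Ioo a b) = 0 := measure_mono_null hsub h0
  rw [Real.volume_Ioo] at hI
  exact absurd (ENNReal.ofReal_eq_zero.1 hI) (not_le.2 (sub_pos.2 hab))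

/-- **Eventually finite exceptional sets have summable measure.**  If from `L₁` on each exceptional set
`{U ∈ (a, b) | p L U}` is finite (hence Lebesgue-null, `Set.Finite.measure_zero`), then the measures are summable:
the series reduces to its first `L₁` terms (`tsum_eq_sum`), each at most `volume (a, b) = b - a < ∞`. [folklore] -/
theorem tsum_volume_ne_top_of_eventually_finite {p : ℕ → ℝ → Prop} {a b : ℝ} (L₁ : ℕ)
    (hfin : ∀ L : ℕ, L₁ ≤ L → Set.Finite {U : ℝ | U ∈ Set.Ioo a b ∧ p L U}) :
    ∑' L : ℕ, volume {U : ℝ | U ∈ Set.Ioo a b ∧ p L U} ≠ ⊤ := by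
  have hzero : ∀ L ∉ Finset.range L₁, volume {U : ℝ | U ∈ Set.Ioo a b ∧ p L U} = 0 := by
    intro L hL
    rw [Finset.mem_range, not_lt] at hL
    exact (hfin L hL).measure_zero volume
  rw [tsum_eq_sum hzero]
  refine ENNReal.sum_ne_top.2 fun L _ => ?_
  refine ne_top_of_le_ne_top (b := volume (Set.Ioo a b)) ?_ (measure_mono fun U hU => hU.1)
  rw [Real.volume_Ioo]
  exact ENNReal.ofReal_ne_top

/-! ### At fixed `L`: finitely many degenerate couplings iff a null set of them -/

/-- **Degenerate couplings of a window: finite iff null.**  At a fixed torus side `L` and doping `δ`, the set `B` of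
couplings `U ∈ (a, b)` at which the `(2⌊(1 - δ)L²/2⌋, S^z = 0)` ground floor of `hubbardTorus 2 L 1 U` is NOT
simple is finite iff it is Lebesgue-null.  (⇒) is `Set.Finite.measure_zero`.  (⇐): by the real-algebraic structure
of the bottom of the affine Hermitian pencil `U ↦ hubbardTorus 2 L 1 U`
(`pencilFiniteness_exists_finset_finrank_const`, p152004: off a finite exceptional set `E` the floor dimension is
constant along intervals) a degenerate non-exceptional coupling `U ∈ (a, b)` carries a whole open interval of
degenerate couplings inside `(a, b)` (simplicity is `dim ≤ 1`, `pencilFiniteness_simple_iff_finrank_le_one`), of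
positive measure; so a null `B` lies inside `E`.  Hence the residue forms "eventually `B_L` finite" (R2) and
"eventually `volume B_L = 0`" coincide, and the Borel–Cantelli form R3 "`∑_L volume B_L < ∞`" is their summable
weakening.  Kato (1966) II §§1.1, 5.1. [folklore] -/
theorem degenerateCouplings_finite_iff_null (L : ℕ) [NeZero L] (δ a b : ℝ) :
    Set.Finite {U : ℝ | U ∈ Set.Ioo a b ∧ ¬ ∀ φ φ' : Fock (Orb (FermionTorus 2 L)), IsGroundStateInSector (hubbardTorus 2 L 1 U) (2 * ⌊(1 - δ) * (L : ℝ) ^ 2 / 2⌋₊) 0 φ → IsGroundStateInSector (hubbardTorus 2 L 1 U) (2 * ⌊(1 - δ) * (L : ℝ) ^ 2 / 2⌋₊) 0 φ' → ∃ c : ℂ, φ' = c • φ} ↔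
      volume {U : ℝ | U ∈ Set.Ioo a b ∧ ¬ ∀ φ φ' : Fock (Orb (FermionTorus 2 L)), IsGroundStateInSector (hubbardTorus 2 L 1 U) (2 * ⌊(1 - δ) * (L : ℝ) ^ 2 / 2⌋₊) 0 φ → IsGroundStateInSector (hubbardTorus 2 L 1 U) (2 * ⌊(1 - δ) * (L : ℝ) ^ 2 / 2⌋₊) 0 φ' → ∃ c : ℂ, φ' = c • φ} = 0 := by
  refine ⟨fun h => h.measure_zero volume, fun hnull => ?_⟩
  -- the finite exceptional set of the pencil at particle number `N_L`
  obtain ⟨E, hE⟩ := pencilFiniteness_exists_finset_finrank_const L (2 * ⌊(1 - δ) * (L : ℝ) ^ 2 / 2⌋₊)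
  refine (E.finite_toSet).subset fun U hU => ?_
  obtain ⟨hUab, hUdeg⟩ := hU
  by_contra hUE
  -- an open interval around `U`, inside `(a, b)` and avoiding `E`
  have hopen : IsOpen (Set.Ioo a b ∩ (↑E : Set ℝ)ᶜ) := isOpen_Ioo.inter E.finite_toSet.isClosed.isOpen_compl
  obtain ⟨ε, hε, hball⟩ := Metric.isOpen_iff.1 hopen U ⟨hUab, hUE⟩
  rw [Real.ball_eq_Ioo] at hball
  -- the floor dimension is constant on it, and `≥ 2` at `U`
  have hconst := hE (Set.Ioo (U - ε) (U + ε)) isPreconnected_Ioo (fun u hu => (hball hu).2)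
  have hUin : U ∈ Set.Ioo (U - ε) (U + ε) := ⟨by linarith, by linarith⟩
  have hdeg : ∀ u ∈ Set.Ioo (U - ε) (U + ε), ¬ ∀ φ φ' : Fock (Orb (FermionTorus 2 L)),
      IsGroundStateInSector (hubbardTorus 2 L 1 u) (2 * ⌊(1 - δ) * (L : ℝ) ^ 2 / 2⌋₊) 0 φ →
      IsGroundStateInSector (hubbardTorus 2 L 1 u) (2 * ⌊(1 - δ) * (L : ℝ) ^ 2 / 2⌋₊) 0 φ' → ∃ c : ℂ, φ' = c • φ := by
    intro u hu hsimple
    apply hUdeg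
    have h1 := (pencilFiniteness_simple_iff_finrank_le_one (hubbardTorus 2 L 1 u)
      (2 * ⌊(1 - δ) * (L : ℝ) ^ 2 / 2⌋₊) 0).1 hsimple
    exact (pencilFiniteness_simple_iff_finrank_le_one (hubbardTorus 2 L 1 U)
      (2 * ⌊(1 - δ) * (L : ℝ) ^ 2 / 2⌋₊) 0).2 ((hconst U hUin u hu).le.trans h1)
  -- so the whole interval is degenerate: positive measure inside a null set
  have hsub : Set.Ioo (U - ε) (U + ε) ⊆ {U : ℝ | U ∈ Set.Ioo a b ∧ ¬ ∀ φ φ' : Fock (Orb (FermionTorus 2 L)), IsGroundStateInSector (hubbardTorus 2 L 1 U) (2 * ⌊(1 - δ) * (L : ℝ) ^ 2 / 2⌋₊) 0 φ → IsGroundStateInSector (hubbardTorus 2 L 1 U) (2 * ⌊(1 - δ) * (L : ℝ) ^ 2 / 2⌋₊) 0 φ' → ∃ c : ℂ, φ' = c • φ} :=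
    fun u hu => ⟨(hball hu).1, hdeg u hu⟩
  have hI : volume (Set.Ioo (U - ε) (U + ε)) = 0 := measure_mono_null hsub hnull
  rw [Real.volume_Ioo] at hI
  have h2 : U + ε - (U - ε) = 2 * ε := by ring
  rw [h2] at hI
  exact absurd (ENNReal.ofReal_eq_zero.1 hI) (not_le.2 (by positivity))

/-! ### Window order + Borel–Cantelli residue ⇒ the crux -/

/-- **Window order + summable degeneracy ⇒ `JmCusp`.**  If zero-excess `d`-wave pair order holds at every coupling
of a window `(a, b)`, `0 < a < b`, at doping `δ ∈ (0, 1/2)`, and the Lebesgue measures of the degenerate-floor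
couplings `B_L = {U ∈ (a, b) | L ≠ 0, L even, (N_L, S^z = 0) floor of hubbardTorus 2 L 1 U not simple}` are
summable in `L`, then `JmCusp` holds: by Borel–Cantelli selection
(`exists_mem_Ioo_eventually_not_of_tsum_ne_top`) some coupling of the window lies in only finitely many `B_L`,
i.e. has an eventually simple floor, and `jmCusp_of_windowOrder_of_eventuallySimple` (p153748) applies. [folklore] -/
theorem jmCusp_of_windowOrder_of_summableDegeneracy {δ a b : ℝ} (hδ : δ ∈ Set.Ioo (0:ℝ) (1 / 2)) (ha : 0 < a)
    (hab : a < b) (hZ : ∀ U ∈ Set.Ioo a b, ∃ c : ℝ, 0 < c ∧ ∀ ε : ℝ, 0 < ε → ∃ L₀ : ℕ, ∀ (L : ℕ) [NeZero L], Even L → L₀ ≤ L → ∃ n : ℕ, (n = 2 * ⌊(1 - δ) * (L : ℝ) ^ 2 / 2⌋₊ ∨ n = 2 * ⌊(1 - δ) * (L : ℝ) ^ 2 / 2⌋₊ - 2) ∧ ∃ v : Fock (Orb (FermionTorus 2 L)), v ∈ szSector n 0 ∧ star v ⬝ᵥ v = 1 ∧ (star v ⬝ᵥ (hubbardTorus 2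 L 1 U *ᵥ v)).re ≤ (hubbardTorus 2 L 1 U).minEnergyOn (szSector n 0) + ε * (L : ℝ) ^ 2 ∧ c * (L : ℝ) ^ 4 ≤ (star (pairField dWaveFormFactor L *ᵥ v) ⬝ᵥ (pairField dWaveFormFactor L *ᵥ v)).re)
    (hsum : ∑' L : ℕ, volume {U : ℝ | U ∈ Set.Ioo a b ∧ L ≠ 0 ∧ Even L ∧ ¬ ∀ φ φ' : Fock (Orb (FermionTorus 2 L)), IsGroundStateInSector (hubbardTorus 2 L 1 U) (2 * ⌊(1 - δ) * (L : ℝ) ^ 2 / 2⌋₊) 0 φ → IsGroundStateInSector (hubbardTorus 2 L 1 U) (2 * ⌊(1 - δ) * (L : ℝ) ^ 2 / 2⌋₊) 0 φ' → ∃ c : ℂ, φ' = c • φ} ≠ ⊤) :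
    JmCusp := by
  obtain ⟨U, hUW, L₀, hgood⟩ := exists_mem_Ioo_eventually_not_of_tsum_ne_top
    (p := fun L U => L ≠ 0 ∧ Even L ∧ ¬ ∀ φ φ' : Fock (Orb (FermionTorus 2 L)), IsGroundStateInSector (hubbardTorus 2 L 1 U) (2 * ⌊(1 - δ) * (L : ℝ) ^ 2 / 2⌋₊) 0 φ → IsGroundStateInSector (hubbardTorus 2 L 1 U) (2 * ⌊(1 - δ) * (L : ℝ) ^ 2 / 2⌋₊) 0 φ' → ∃ c : ℂ, φ' = c • φ) hab hsum
  refine jmCusp_of_windowOrder_of_eventuallySimple hδ ha hZ ⟨U, hUW, L₀, fun L _ hE hL => ?_⟩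
  have h := hgood L hL
  push Not at h
  exact h (NeZero.ne L) hE

/-- **Eventually finitely many degenerate couplings ⇒ summable degeneracy** (the residue form of
`jmCusp_of_windowOrder_of_finiteDegenerate` ⇒ R3 on the same window): finite sets are null and the series has
finitely many non-zero terms (`tsum_volume_ne_top_of_eventually_finite`). [folklore] -/
theorem summableDegeneracy_of_finiteDegenerate {δ a b : ℝ}
    (hfin : ∃ L₁ : ℕ, ∀ (L : ℕ) [NeZero L], Even L → L₁ ≤ L →
      Set.Finite {U : ℝ | U ∈ Set.Ioo a b ∧ ¬ ∀ φ φ' : Fock (Orb (FermionTorus 2 L)), IsGroundStateInSector (hubbardTorus 2 L 1 U) (2 * ⌊(1 - δ) * (L : ℝ) ^ 2 / 2⌋₊) 0 φ → IsGroundStateInSector (hubbardTorus 2 L 1 U) (2 * ⌊(1 - δ) * (L : ℝ) ^ 2 / 2⌋₊) 0 φ' → ∃ c : ℂ, φ' = c • φ}) :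
    ∑' L : ℕ, volume {U : ℝ | U ∈ Set.Ioo a b ∧ L ≠ 0 ∧ Even L ∧ ¬ ∀ φ φ' : Fock (Orb (FermionTorus 2 L)), IsGroundStateInSector (hubbardTorus 2 L 1 U) (2 * ⌊(1 - δ) * (L : ℝ) ^ 2 / 2⌋₊) 0 φ → IsGroundStateInSector (hubbardTorus 2 L 1 U) (2 * ⌊(1 - δ) * (L : ℝ) ^ 2 / 2⌋₊) 0 φ' → ∃ c : ℂ, φ' = c • φ} ≠ ⊤ := by
  obtain ⟨L₁, hfin⟩ := hfin
  refine tsum_volume_ne_top_of_eventually_finite (p := fun L U => L ≠ 0 ∧ Even L ∧ ¬ ∀ φ φ' : Fock (Orb (FermionTorus 2 L)), IsGroundStateInSector (hubbardTorus 2 L 1 U) (2 * ⌊(1 - δ) * (L : ℝ) ^ 2 / 2⌋₊) 0 φ → IsGroundStateInSector (hubbardTorus 2 L 1 U) (2 * ⌊(1 - δ) * (L : ℝ) ^ 2 / 2⌋₊) 0 φ' → ∃ c : ℂ, φ' = c • φ) L₁ fun L hL => ?_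
  by_cases hL0 : L = 0
  · exact Set.finite_empty.subset fun U hU => hU.2.1 hL0
  by_cases hE : Even L
  · haveI : NeZero L := ⟨hL0⟩
    exact (hfin L hE hL).subset fun U hU => ⟨hU.1, hU.2.2.2⟩
  · exact Set.finite_empty.subset fun U hU => hE hU.2.2.1

/-- **Eventually dense simplicity ⇒ summable degeneracy** (the generic residue R2 ⇒ R3 on the same window): density
leaves finitely many degenerate couplings at each large even `L` (`stub_pencilFiniteness`, p152004), and
`summableDegeneracy_of_finiteDegenerate` applies. [folklore] -/
theorem summableDegeneracy_of_denseSimple {δ a b : ℝ} (hab : a < b)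
    (hdense : ∃ L₁ : ℕ, ∀ (L : ℕ) [NeZero L], Even L → L₁ ≤ L →
      ∀ a' b' : ℝ, a ≤ a' → a' < b' → b' ≤ b → ∃ U ∈ Set.Ioo a' b', ∀ φ φ' : Fock (Orb (FermionTorus 2 L)), IsGroundStateInSector (hubbardTorus 2 L 1 U) (2 * ⌊(1 - δ) * (L : ℝ) ^ 2 / 2⌋₊) 0 φ → IsGroundStateInSector (hubbardTorus 2 L 1 U) (2 * ⌊(1 - δ) * (L : ℝ) ^ 2 / 2⌋₊) 0 φ' → ∃ c : ℂ, φ' = c • φ) :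
    ∑' L : ℕ, volume {U : ℝ | U ∈ Set.Ioo a b ∧ L ≠ 0 ∧ Even L ∧ ¬ ∀ φ φ' : Fock (Orb (FermionTorus 2 L)), IsGroundStateInSector (hubbardTorus 2 L 1 U) (2 * ⌊(1 - δ) * (L : ℝ) ^ 2 / 2⌋₊) 0 φ → IsGroundStateInSector (hubbardTorus 2 L 1 U) (2 * ⌊(1 - δ) * (L : ℝ) ^ 2 / 2⌋₊) 0 φ' → ∃ c : ℂ, φ' = c • φ} ≠ ⊤ := by
  obtain ⟨L₁, hdense⟩ := hdense
  exact summableDegeneracy_of_finiteDegenerate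
    ⟨L₁, fun L _ hE hL => stub_pencilFiniteness L δ a b hab (hdense L hE hL)⟩

/-! ### The line's composition with the Borel–Cantelli residue (registered stubs as hypotheses) -/

/-- **Line `cocountable-coupling-selection`, composed (rev c11-3).**  From its two registered stubs taken as
hypotheses — `hA`: an ordered window (some doping `δ ∈ (0, 1/2)` and couplings `0 < a < b` with zero-excess `d`-wave
pair order at every `U ∈ (a, b)`; the summit's open core in window form) and `hR`: the Borel–Cantelli residue R3
(every ordered window contains a sub-window on which the coupling-measure of floor degeneracy is summable along `L`)
— the crux `JmCusp` follows: restrict the order to the sub-window (`windowOrder_mono`) and apply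
`jmCusp_of_windowOrder_of_summableDegeneracy`. [folklore] -/
theorem jmCusp_of_orderedWindow_of_summableDegeneracy : (∃ δ ∈ Set.Ioo (0:ℝ) (1 / 2), ∃ a b : ℝ, 0 < a ∧ a < b ∧ ∀ U ∈ Set.Ioo a b, ∃ c : ℝ, 0 < c ∧ ∀ ε : ℝ, 0 < ε → ∃ L₀ : ℕ, ∀ (L : ℕ) [NeZero L], Even L → L₀ ≤ L → ∃ n : ℕ, (n = 2 * ⌊(1 - δ) * (L : ℝ) ^ 2 / 2⌋₊ ∨ n = 2 * ⌊(1 - δ) * (L : ℝ) ^ 2 / 2⌋₊ - 2) ∧ ∃ v : Literature.MathematicalPhysics.QuantumLattice.Fock (Literature.MathematicalPhysics.QuantumLattice.Orb (Literature.MathematicalPhysics.QuantumLattice.FermionTorus 2 L)), v ∈ Literature.MathematicalPhysics.QuantumLattice.szSector n 0 ∧ star v ⬝ᵥ v = 1 ∧ (star v ⬝ᵥ (Literature.MathematicalPhysics.QuantumLattice.hubbardTorus 2 L 1 U *ᵥ v)).re ≤ (Literature.MathematicalPhysics.QuantumLattice.hubbardTorus 2 L 1 U).minEnergyOn (Literature.MathematicalPhysics.QuantumLattice.szSector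 n 0) + ε * (L : ℝ) ^ 2 ∧ c * (L : ℝ) ^ 4 ≤ (star (Literature.MathematicalPhysics.QuantumLattice.pairField Literature.MathematicalPhysics.QuantumLattice.dWaveFormFactor L *ᵥ v) ⬝ᵥ (Literature.MathematicalPhysics.QuantumLattice.pairField Literature.MathematicalPhysics.QuantumLattice.dWaveFormFactor L *ᵥ v)).re) → (∀ δ ∈ Set.Ioo (0:ℝ) (1 / 2), ∀ a b : ℝ, 0 < a → a < b → (∀ U ∈ Set.Ioo a b, ∃ c : ℝ, 0 < c ∧ ∀ ε : ℝ, 0 < ε → ∃ L₀ : ℕ, ∀ (L : ℕ) [NeZero L], Even L → L₀ ≤ L → ∃ n : ℕ, (n = 2 * ⌊(1 - δ) * (L : ℝ) ^ 2 / 2⌋₊ ∨ n = 2 * ⌊(1 - δ) * (L : ℝ) ^ 2 / 2⌋₊ - 2) ∧ ∃ v : Literature.MathematicalPhysics.QuantumLattice.Fock (Literature.MathematicalPhysics.QuantumLattice.Orb (Literature.MathematicalPhysics.QuantumLattice.FermionTorus 2 L)), v ∈ Literature.MathematicalPhysics.QuantumLattice.szSector n 0 ∧ star v ⬝ᵥ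 v = 1 ∧ (star v ⬝ᵥ (Literature.MathematicalPhysics.QuantumLattice.hubbardTorus 2 L 1 U *ᵥ v)).re ≤ (Literature.MathematicalPhysics.QuantumLattice.hubbardTorus 2 L 1 U).minEnergyOn (Literature.MathematicalPhysics.QuantumLattice.szSector n 0) + ε * (L : ℝ) ^ 2 ∧ c * (L : ℝ) ^ 4 ≤ (star (Literature.MathematicalPhysics.QuantumLattice.pairField Literature.MathematicalPhysics.QuantumLattice.dWaveFormFactor L *ᵥ v) ⬝ᵥ (Literature.MathematicalPhysics.QuantumLattice.pairField Literature.MathematicalPhysics.QuantumLattice.dWaveFormFactor L *ᵥ v)).re) → ∃ a' b' : ℝ, a ≤ a' ∧ a' < b' ∧ b' ≤ b ∧ ∑' L : ℕ, MeasureTheory.volume {U : ℝ | U ∈ Set.Ioo a' b' ∧ L ≠ 0 ∧ Even L ∧ ¬ ∀ φ φ' : Literature.MathematicalPhysics.QuantumLattice.Fock (Literature.MathematicalPhysics.QuantumLattice.Orb (Literature.MathematicalPhysics.QuantumLattice.FermionTorus 2 L)), Literature.MathematicalPhysics.QuantumLattice.IsGroundStateInSector (Literature.MathematicalPhysics.QuantumLattice.hubbardTorus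 2 L 1 U) (2 * ⌊(1 - δ) * (L : ℝ) ^ 2 / 2⌋₊) 0 φ → Literature.MathematicalPhysics.QuantumLattice.IsGroundStateInSector (Literature.MathematicalPhysics.QuantumLattice.hubbardTorus 2 L 1 U) (2 * ⌊(1 - δ) * (L : ℝ) ^ 2 / 2⌋₊) 0 φ' → ∃ c : ℂ, φ' = c • φ} ≠ ⊤) → Summit.HubbardSuperconductivity.HubbardSuperconductivity.Theses.JosephsonMirror.JmCusp := by
  intro hA hR
  obtain ⟨δ, hδ, a, b, ha, hab, hZ⟩ := hA
  obtain ⟨a', b', haa', ha'b', hb'b, hsum⟩ := hR δ hδ a b ha hab hZ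
  exact jmCusp_of_windowOrder_of_summableDegeneracy hδ (lt_of_lt_of_le ha haa') ha'b'
    (windowOrder_mono haa' hb'b hZ) hsum

/-- **R2 ⇒ R3 (registered forms).**  The generic-simplicity residue of the skeleton rev c11-2 (a sub-window with
eventually dense simple-floor couplings) implies the Borel–Cantelli residue of rev c11-3 (a sub-window with summable
coupling-measure of floor degeneracy), on the same sub-window (`summableDegeneracy_of_denseSimple`).  This certifies
that the reshape rev c11-2 → rev c11-3 only WEAKENED the residue. [folklore] -/
theorem summableDegeneracy_of_genericSimplicity : (∀ δ ∈ Set.Ioo (0:ℝ) (1 / 2), ∀ a b : ℝ, 0 < a → a < b → (∀ U ∈ Set.Ioo a b, ∃ c : ℝ, 0 < c ∧ ∀ ε : ℝ, 0 < ε → ∃ L₀ : ℕ, ∀ (L : ℕ) [NeZero L], Even L → L₀ ≤ L → ∃ n : ℕ, (n = 2 * ⌊(1 - δ) * (L : ℝ) ^ 2 / 2⌋₊ ∨ n = 2 * ⌊(1 - δ) * (L : ℝ) ^ 2 / 2⌋₊ - 2) ∧ ∃ v : Literature.MathematicalPhysics.QuantumLattice.Fock (Literature.MathematicalPhysics.QuantumLattice.Orb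 (Literature.MathematicalPhysics.QuantumLattice.FermionTorus 2 L)), v ∈ Literature.MathematicalPhysics.QuantumLattice.szSector n 0 ∧ star v ⬝ᵥ v = 1 ∧ (star v ⬝ᵥ (Literature.MathematicalPhysics.QuantumLattice.hubbardTorus 2 L 1 U *ᵥ v)).re ≤ (Literature.MathematicalPhysics.QuantumLattice.hubbardTorus 2 L 1 U).minEnergyOn (Literature.MathematicalPhysics.QuantumLattice.szSector n 0) + ε * (L : ℝ) ^ 2 ∧ c * (L : ℝ) ^ 4 ≤ (star (Literature.MathematicalPhysics.QuantumLattice.pairField Literature.MathematicalPhysics.QuantumLattice.dWaveFormFactor L *ᵥ v) ⬝ᵥ (Literature.MathematicalPhysics.QuantumLattice.pairField Literature.MathematicalPhysics.QuantumLattice.dWaveFormFactor L *ᵥ v)).re) → ∃ a' b' : ℝ, a ≤ a' ∧ a' < b' ∧ b' ≤ b ∧ ∃ L₁ : ℕ, ∀ (L : ℕ) [NeZero L], Even L → L₁ ≤ L → ∀ a'' b'' : ℝ, a' ≤ a'' → a'' < b'' → b'' ≤ b' → ∃ U ∈ Set.Ioo a'' b'', ∀ φ φ' : Literature.MathematicalPhysics.QuantumLattice.Fock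 (Literature.MathematicalPhysics.QuantumLattice.Orb (Literature.MathematicalPhysics.QuantumLattice.FermionTorus 2 L)), Literature.MathematicalPhysics.QuantumLattice.IsGroundStateInSector (Literature.MathematicalPhysics.QuantumLattice.hubbardTorus 2 L 1 U) (2 * ⌊(1 - δ) * (L : ℝ) ^ 2 / 2⌋₊) 0 φ → Literature.MathematicalPhysics.QuantumLattice.IsGroundStateInSector (Literature.MathematicalPhysics.QuantumLattice.hubbardTorus 2 L 1 U) (2 * ⌊(1 - δ) * (L : ℝ) ^ 2 / 2⌋₊) 0 φ' → ∃ c : ℂ, φ' = c • φ) → (∀ δ ∈ Set.Ioo (0:ℝ) (1 / 2), ∀ a b : ℝ, 0 < a → a < b → (∀ U ∈ Set.Ioo a b, ∃ c : ℝ, 0 < c ∧ ∀ ε : ℝ, 0 < ε → ∃ L₀ : ℕ, ∀ (L : ℕ) [NeZero L], Even L → L₀ ≤ L → ∃ n : ℕ, (n = 2 * ⌊(1 - δ) * (L : ℝ) ^ 2 / 2⌋₊ ∨ n = 2 * ⌊(1 - δ) * (L : ℝ) ^ 2 / 2⌋₊ - 2) ∧ ∃ v : Literature.MathematicalPhysics.QuantumLattice.Fock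 (Literature.MathematicalPhysics.QuantumLattice.Orb (Literature.MathematicalPhysics.QuantumLattice.FermionTorus 2 L)), v ∈ Literature.MathematicalPhysics.QuantumLattice.szSector n 0 ∧ star v ⬝ᵥ v = 1 ∧ (star v ⬝ᵥ (Literature.MathematicalPhysics.QuantumLattice.hubbardTorus 2 L 1 U *ᵥ v)).re ≤ (Literature.MathematicalPhysics.QuantumLattice.hubbardTorus 2 L 1 U).minEnergyOn (Literature.MathematicalPhysics.QuantumLattice.szSector n 0) + ε * (L : ℝ) ^ 2 ∧ c * (L : ℝ) ^ 4 ≤ (star (Literature.MathematicalPhysics.QuantumLattice.pairField Literature.MathematicalPhysics.QuantumLattice.dWaveFormFactor L *ᵥ v) ⬝ᵥ (Literature.MathematicalPhysics.QuantumLattice.pairField Literature.MathematicalPhysics.QuantumLattice.dWaveFormFactor L *ᵥ v)).re) → ∃ a' b' : ℝ, a ≤ a' ∧ a' < b' ∧ b' ≤ b ∧ ∑' L : ℕ, MeasureTheory.volume {U : ℝ | U ∈ Set.Ioo a' b' ∧ L ≠ 0 ∧ Even L ∧ ¬ ∀ φ φ' : Literature.MathematicalPhysics.QuantumLattice.Fock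 (Literature.MathematicalPhysics.QuantumLattice.Orb (Literature.MathematicalPhysics.QuantumLattice.FermionTorus 2 L)), Literature.MathematicalPhysics.QuantumLattice.IsGroundStateInSector (Literature.MathematicalPhysics.QuantumLattice.hubbardTorus 2 L 1 U) (2 * ⌊(1 - δ) * (L : ℝ) ^ 2 / 2⌋₊) 0 φ → Literature.MathematicalPhysics.QuantumLattice.IsGroundStateInSector (Literature.MathematicalPhysics.QuantumLattice.hubbardTorus 2 L 1 U) (2 * ⌊(1 - δ) * (L : ℝ) ^ 2 / 2⌋₊) 0 φ' → ∃ c : ℂ, φ' = c • φ} ≠ ⊤) := by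
  intro hR δ hδ a b ha hab hZ
  obtain ⟨a', b', haa', ha'b', hb'b, L₁, hdense⟩ := hR δ hδ a b ha hab hZ
  exact ⟨a', b', haa', ha'b', hb'b, summableDegeneracy_of_denseSimple ha'b' ⟨L₁, hdense⟩⟩

/-! ### The window supplied by the existing open core items (statements verbatim) -/

/-- **stmt-8807 ∧ R3 ⇒ `JmCusp`.**  The statement of stmt-HubbardSuperconductivity-8807 `LogColdTorus.LogColdDWaveOrder`
(verbatim) and the Borel–Cantelli residue give the crux (`stub_logColdGivesWindowOrder`, p152504). [folklore] -/
theorem jmCusp_of_logColdDWaveOrder_of_summableDegeneracy : (∃ δ ∈ Set.Ioo (0:ℝ) (1/2), ∃ U₁ U₂ : ℝ, 0 < U₁ ∧ U₁ < U₂ ∧ ∃ κ₀ c : ℝ, 0 < κ₀ ∧ 0 < c ∧ ∀ κ : ℝ, κ₀ ≤ κ → ∃ L₀ : ℕ, ∀ U ∈ Set.Ioo U₁ U₂, ∀ (L : ℕ) [NeZero L], L₀ ≤ L → Even L → let p : Finset (Literature.MathematicalPhysics.QuantumLattice.Orb (Literature.MathematicalPhysics.QuantumLattice.FermionTorus 2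 L)) → Prop := fun s => s.card = 2 * ⌊(1 - δ) * (L : ℝ) ^ 2 / 2⌋₊ ∧ 2 * (s.filter fun i => (ofLex i).2 = 0).card = 2 * ⌊(1 - δ) * (L : ℝ) ^ 2 / 2⌋₊; c * (L : ℝ) ^ 4 ≤ (Matrix.gibbsState (κ * Real.log L) ((Literature.MathematicalPhysics.QuantumLattice.hubbardTorus 2 L 1 U).toBlock p p) (((Literature.MathematicalPhysics.QuantumLattice.pairField Literature.MathematicalPhysics.QuantumLattice.dWaveFormFactor L)ᴴ * Literature.MathematicalPhysics.QuantumLattice.pairField Literature.MathematicalPhysics.QuantumLattice.dWaveFormFactor L).toBlock p p)).re) → (∀ δ ∈ Set.Ioo (0:ℝ) (1 / 2), ∀ a b : ℝ, 0 < a → a < b → (∀ U ∈ Set.Ioo a b, ∃ c : ℝ, 0 < c ∧ ∀ ε : ℝ, 0 < ε → ∃ L₀ : ℕ, ∀ (L : ℕ) [NeZero L], Even L → L₀ ≤ L → ∃ n : ℕ, (n = 2 * ⌊(1 - δ) * (L : ℝ) ^ 2 / 2⌋₊ ∨ n = 2 * ⌊(1 - δ) * (L : ℝ) ^ 2 / 2⌋₊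 - 2) ∧ ∃ v : Literature.MathematicalPhysics.QuantumLattice.Fock (Literature.MathematicalPhysics.QuantumLattice.Orb (Literature.MathematicalPhysics.QuantumLattice.FermionTorus 2 L)), v ∈ Literature.MathematicalPhysics.QuantumLattice.szSector n 0 ∧ star v ⬝ᵥ v = 1 ∧ (star v ⬝ᵥ (Literature.MathematicalPhysics.QuantumLattice.hubbardTorus 2 L 1 U *ᵥ v)).re ≤ (Literature.MathematicalPhysics.QuantumLattice.hubbardTorus 2 L 1 U).minEnergyOn (Literature.MathematicalPhysics.QuantumLattice.szSector n 0) + ε * (L : ℝ) ^ 2 ∧ c * (L : ℝ) ^ 4 ≤ (star (Literature.MathematicalPhysics.QuantumLattice.pairField Literature.MathematicalPhysics.QuantumLattice.dWaveFormFactor L *ᵥ v) ⬝ᵥ (Literature.MathematicalPhysics.QuantumLattice.pairField Literature.MathematicalPhysics.QuantumLattice.dWaveFormFactor L *ᵥ v)).re) → ∃ a' b' : ℝ, a ≤ a' ∧ a' < b' ∧ b' ≤ b ∧ ∑' L : ℕ, MeasureTheory.volume {U : ℝ | U ∈ Set.Ioo a' b' ∧ L ≠ 0 ∧ Even L ∧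 ¬ ∀ φ φ' : Literature.MathematicalPhysics.QuantumLattice.Fock (Literature.MathematicalPhysics.QuantumLattice.Orb (Literature.MathematicalPhysics.QuantumLattice.FermionTorus 2 L)), Literature.MathematicalPhysics.QuantumLattice.IsGroundStateInSector (Literature.MathematicalPhysics.QuantumLattice.hubbardTorus 2 L 1 U) (2 * ⌊(1 - δ) * (L : ℝ) ^ 2 / 2⌋₊) 0 φ → Literature.MathematicalPhysics.QuantumLattice.IsGroundStateInSector (Literature.MathematicalPhysics.QuantumLattice.hubbardTorus 2 L 1 U) (2 * ⌊(1 - δ) * (L : ℝ) ^ 2 / 2⌋₊) 0 φ' → ∃ c : ℂ, φ' = c • φ} ≠ ⊤) → Summit.HubbardSuperconductivity.HubbardSuperconductivity.Theses.JosephsonMirror.JmCusp :=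
  fun h8807 hR => jmCusp_of_orderedWindow_of_summableDegeneracy (stub_logColdGivesWindowOrder h8807) hR

/-- **stmt-2079 ∧ R3 ⇒ `JmCusp`.**  The statement of stmt-HubbardSuperconductivity-2079
`BalabanIR.BirGroundStateAverageLRO` (verbatim) and the Borel–Cantelli residue give the crux (`orderedWindow_of_bir2079`,
p152676). [folklore] -/
theorem jmCusp_of_bir2079_of_summableDegeneracy : (∃ δ ∈ Set.Ioo (0:ℝ) (1/2), ∃ U₁ U₂ c : ℝ, 0 < U₁ ∧ U₁ < U₂ ∧ 0 < c ∧ ∀ U ∈ Set.Ioo U₁ U₂, ∃ L₀ : ℕ, ∀ (L : ℕ) [NeZero L], L₀ ≤ L → Even L → let N : ℕ := 2 * ⌊(1 - δ) * (L : ℝ) ^ 2 / 2⌋₊; let H := Literature.MathematicalPhysics.QuantumLattice.hubbardTorus 2 L 1 U; let S := Literature.MathematicalPhysics.QuantumLattice.szSector (Λ := Literature.MathematicalPhysics.QuantumLattice.FermionTorus 2 L) N 0; let E₀ := S ⊓ Module.End.eigenspace (Matrix.toLin' H) ((H.minEnergyOn S : ℝ) : ℂ); let P := Literature.MathematicalPhysics.QuantumLattice.projMatrix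 (E₀.map (Literature.MathematicalPhysics.QuantumLattice.Fock.toEuclidean (ι := Literature.MathematicalPhysics.QuantumLattice.Orb (Literature.MathematicalPhysics.QuantumLattice.FermionTorus 2 L)) : Literature.MathematicalPhysics.QuantumLattice.Fock (Literature.MathematicalPhysics.QuantumLattice.Orb (Literature.MathematicalPhysics.QuantumLattice.FermionTorus 2 L)) →ₗ[ℂ] EuclideanSpace ℂ (Finset (Literature.MathematicalPhysics.QuantumLattice.Orb (Literature.MathematicalPhysics.QuantumLattice.FermionTorus 2 L))))); c * (L : ℝ) ^ 4 * P.trace.re ≤ (P * (Matrix.conjTranspose (Literature.MathematicalPhysics.QuantumLattice.pairField Literature.MathematicalPhysics.QuantumLattice.dWaveFormFactor L) * Literature.MathematicalPhysics.QuantumLattice.pairField Literature.MathematicalPhysics.QuantumLattice.dWaveFormFactor L)).trace.re) → (∀ δ ∈ Set.Ioo (0:ℝ) (1 / 2), ∀ a b : ℝ, 0 < a → a < b → (∀ U ∈ Set.Ioo a b, ∃ c : ℝ, 0 < c ∧ ∀ ε : ℝ, 0 < ε → ∃ L₀ : ℕ, ∀ (L : ℕ) [NeZero L], Even L → L₀ ≤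 L → ∃ n : ℕ, (n = 2 * ⌊(1 - δ) * (L : ℝ) ^ 2 / 2⌋₊ ∨ n = 2 * ⌊(1 - δ) * (L : ℝ) ^ 2 / 2⌋₊ - 2) ∧ ∃ v : Literature.MathematicalPhysics.QuantumLattice.Fock (Literature.MathematicalPhysics.QuantumLattice.Orb (Literature.MathematicalPhysics.QuantumLattice.FermionTorus 2 L)), v ∈ Literature.MathematicalPhysics.QuantumLattice.szSector n 0 ∧ star v ⬝ᵥ v = 1 ∧ (star v ⬝ᵥ (Literature.MathematicalPhysics.QuantumLattice.hubbardTorus 2 L 1 U *ᵥ v)).re ≤ (Literature.MathematicalPhysics.QuantumLattice.hubbardTorus 2 L 1 U).minEnergyOn (Literature.MathematicalPhysics.QuantumLattice.szSector n 0) + ε * (L : ℝ) ^ 2 ∧ c * (L : ℝ) ^ 4 ≤ (star (Literature.MathematicalPhysics.QuantumLattice.pairField Literature.MathematicalPhysics.QuantumLattice.dWaveFormFactor L *ᵥ v) ⬝ᵥ (Literature.MathematicalPhysics.QuantumLattice.pairField Literature.MathematicalPhysics.QuantumLattice.dWaveFormFactor L *ᵥ v)).re) → ∃ a' b' : ℝ,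 a ≤ a' ∧ a' < b' ∧ b' ≤ b ∧ ∑' L : ℕ, MeasureTheory.volume {U : ℝ | U ∈ Set.Ioo a' b' ∧ L ≠ 0 ∧ Even L ∧ ¬ ∀ φ φ' : Literature.MathematicalPhysics.QuantumLattice.Fock (Literature.MathematicalPhysics.QuantumLattice.Orb (Literature.MathematicalPhysics.QuantumLattice.FermionTorus 2 L)), Literature.MathematicalPhysics.QuantumLattice.IsGroundStateInSector (Literature.MathematicalPhysics.QuantumLattice.hubbardTorus 2 L 1 U) (2 * ⌊(1 - δ) * (L : ℝ) ^ 2 / 2⌋₊) 0 φ → Literature.MathematicalPhysics.QuantumLattice.IsGroundStateInSector (Literature.MathematicalPhysics.QuantumLattice.hubbardTorus 2 L 1 U) (2 * ⌊(1 - δ) * (L : ℝ) ^ 2 / 2⌋₊) 0 φ' → ∃ c : ℂ, φ' = c • φ} ≠ ⊤) → Summit.HubbardSuperconductivity.HubbardSuperconductivity.Theses.JosephsonMirror.JmCusp :=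
  fun h2079 hR => jmCusp_of_orderedWindow_of_summableDegeneracy (orderedWindow_of_bir2079 h2079) hR

/-- **stmt-1634 ∧ R3 ⇒ `JmCusp`.**  The statement of stmt-HubbardSuperconductivity-1634 `AbelianDuality.Thesis`
(verbatim) and the Borel–Cantelli residue give the crux (`orderedWindow_of_thesis1634`, p152676). [folklore] -/
theorem jmCusp_of_thesis1634_of_summableDegeneracy : (∃ δ ∈ Set.Ioo (0:ℝ) (1/2), ∃ U₁ U₂ : ℝ, 0 < U₁ ∧ U₁ < U₂ ∧ ∃ c : ℝ, 0 < c ∧ ∃ L₀ : ℕ, ∀ U ∈ Set.Ioo U₁ U₂, ∀ (L : ℕ) [NeZero L], L₀ ≤ L → Even L → let p : Finset (Literature.MathematicalPhysics.QuantumLattice.Orb (Literature.MathematicalPhysics.QuantumLattice.FermionTorus 2 L)) → Prop := fun s => s.card = 2 * ⌊(1 - δ) * (L : ℝ) ^ 2 / 2⌋₊ ∧ 2 * (s.filter fun i => (ofLex i).2 = 0).card = 2 * ⌊(1 - δ) * (L : ℝ) ^ 2 / 2⌋₊; c * (L : ℝ) ^ 4 ≤ (((Literature.MathematicalPhysics.QuantumLattice.hubbardTorus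 2 L 1 U).toBlock p p).groundStateFunctional (((Literature.MathematicalPhysics.QuantumLattice.pairField Literature.MathematicalPhysics.QuantumLattice.dWaveFormFactor L)ᴴ * Literature.MathematicalPhysics.QuantumLattice.pairField Literature.MathematicalPhysics.QuantumLattice.dWaveFormFactor L).toBlock p p)).re) → (∀ δ ∈ Set.Ioo (0:ℝ) (1 / 2), ∀ a b : ℝ, 0 < a → a < b → (∀ U ∈ Set.Ioo a b, ∃ c : ℝ, 0 < c ∧ ∀ ε : ℝ, 0 < ε → ∃ L₀ : ℕ, ∀ (L : ℕ) [NeZero L], Even L → L₀ ≤ L → ∃ n : ℕ, (n = 2 * ⌊(1 - δ) * (L : ℝ) ^ 2 / 2⌋₊ ∨ n = 2 * ⌊(1 - δ) * (L : ℝ) ^ 2 / 2⌋₊ - 2) ∧ ∃ v : Literature.MathematicalPhysics.QuantumLattice.Fock (Literature.MathematicalPhysics.QuantumLattice.Orb (Literature.MathematicalPhysics.QuantumLattice.FermionTorus 2 L)), v ∈ Literature.MathematicalPhysics.QuantumLattice.szSector n 0 ∧ star v ⬝ᵥ v = 1 ∧ (star v ⬝ᵥ (Literature.MathematicalPhysics.QuantumLattice.hubbardTorus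 2 L 1 U *ᵥ v)).re ≤ (Literature.MathematicalPhysics.QuantumLattice.hubbardTorus 2 L 1 U).minEnergyOn (Literature.MathematicalPhysics.QuantumLattice.szSector n 0) + ε * (L : ℝ) ^ 2 ∧ c * (L : ℝ) ^ 4 ≤ (star (Literature.MathematicalPhysics.QuantumLattice.pairField Literature.MathematicalPhysics.QuantumLattice.dWaveFormFactor L *ᵥ v) ⬝ᵥ (Literature.MathematicalPhysics.QuantumLattice.pairField Literature.MathematicalPhysics.QuantumLattice.dWaveFormFactor L *ᵥ v)).re) → ∃ a' b' : ℝ, a ≤ a' ∧ a' < b' ∧ b' ≤ b ∧ ∑' L : ℕ, MeasureTheory.volume {U : ℝ | U ∈ Set.Ioo a' b' ∧ L ≠ 0 ∧ Even L ∧ ¬ ∀ φ φ' : Literature.MathematicalPhysics.QuantumLattice.Fock (Literature.MathematicalPhysics.QuantumLattice.Orb (Literature.MathematicalPhysics.QuantumLattice.FermionTorus 2 L)), Literature.MathematicalPhysics.QuantumLattice.IsGroundStateInSector (Literature.MathematicalPhysics.QuantumLattice.hubbardTorus 2 L 1 U) (2 * ⌊(1 - δ) * (L : ℝ) ^ 2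 / 2⌋₊) 0 φ → Literature.MathematicalPhysics.QuantumLattice.IsGroundStateInSector (Literature.MathematicalPhysics.QuantumLattice.hubbardTorus 2 L 1 U) (2 * ⌊(1 - δ) * (L : ℝ) ^ 2 / 2⌋₊) 0 φ' → ∃ c : ℂ, φ' = c • φ} ≠ ⊤) → Summit.HubbardSuperconductivity.HubbardSuperconductivity.Theses.JosephsonMirror.JmCusp :=
  fun h1634 hR => jmCusp_of_orderedWindow_of_summableDegeneracy (orderedWindow_of_thesis1634 h1634) hR

end Summit.HubbardSuperconductivity.HubbardSuperconductivity.Theorems.JosephsonMirror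

end
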